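import Mathlib
import HarnessLib
import Literature.Probability.LatticeModels.TriangularLatticeProofs
import Literature.Probability.RandomPlanarGeometry.HexParafermion

/-!
# Lattice Riemann sums, part 1: one coset of the triangular lattice
(helper for `RetrievalSynthesisR`, stmt-CriticalPhenomena-14011, route `SAWPhaseRetrieval`)

Folklore analysis used by the layer-1 glue `RetrievalSynthesisR`: for a continuous compactly
supported `g : ℂ → ℂ`, `δ² Σ_{k ∈ ℤ²} g(δ (triEmbed k + t)) → (Im ζ)⁻¹ ∫ g` as `δ → 0⁺`
(`tendsto_coset_sum`; one coset of the triangular lattice `ℤ + ℤζ`, `ζ = e^{iπ/3}`, covolume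
`Im ζ = √3/2`). Proof: compare `g` with the step function constant on the lattice cells (uniform
continuity of `g`); the cells are preimages of unit squares under an explicit affine map, so their
volume is `δ² Im ζ`. Lattice coordinates of `z` in the real basis `(1, ζ)` are written out as
`z.re - z.im / Im ζ * Re ζ` and `z.im / Im ζ` throughout (no auxiliary definitions). Part 2
(`…RRiemann.lean`) sums the three mid-edge cosets of the hexagonal lattice.
-/

noncomputable section

namespace Summit.CriticalPhenomena.SAWScalingLimit.Theorems.RetrievalSynthesisR

open scoped BigOperators Topology
open Filter Set Metric MeasureTheory Complex
open Literature.Probability.LatticeModels Literature.Probability.RandomPlanarGeometry.SAW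

/-! ### Lattice coordinates `z = (z.re - z.im / Im ζ * Re ζ) + (z.im / Im ζ) · ζ` -/

/-- `a + c ζ` in cartesian coordinates. -/
theorem ofReal_add_ofReal_mul_triZeta (a c : ℝ) :
    (a : ℂ) + (c : ℂ) * triZeta = ⟨a + c * triZeta.re, c * triZeta.im⟩ := by
  apply Complex.ext <;> simp

/-- Reconstruction of `z` from its lattice coordinates. -/
theorem latA_add_latC (z : ℂ) :
    ((z.re - z.im / triZeta.im * triZeta.re : ℝ) : ℂ) + ((z.im / triZeta.im : ℝ) : ℂ) * triZeta = z := by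
  rw [ofReal_add_ofReal_mul_triZeta]
  have h : 0 < triZeta.im := by rw [triZeta_im]; positivity
  apply Complex.ext
  · simp
  · simp only
    field_simp

/-- The second coordinate of `a + c ζ` is `c`. -/
theorem latC_of (a c : ℝ) : ((a : ℂ) + (c : ℂ) * triZeta).im / triZeta.im = c := by
  rw [ofReal_add_ofReal_mul_triZeta]
  have h : 0 < triZeta.im := by rw [triZeta_im]; positivity
  field_simp

/-- The first coordinate of `a + c ζ` is `a`. -/
theorem latA_of (a c : ℝ) :
    ((a : ℂ) + (c : ℂ) * triZeta).re - ((a : ℂ) + (c : ℂ) * triZeta).im / triZeta.im * triZeta.re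
      = a := by
  rw [latC_of, ofReal_add_ofReal_mul_triZeta]
  simp

/-- `triEmbed k = k₀ + k₁ ζ` with real coefficients. -/
theorem triEmbed_eq_ofReal (k : Site 2) :
    triEmbed k = ((k 0 : ℝ) : ℂ) + ((k 1 : ℝ) : ℂ) * triZeta := by
  simp only [triEmbed, ofReal_intCast]

/-- Norm bound in lattice coordinates: `‖a + c ζ‖ ≤ |a| + |c|` (`‖ζ‖ = 1`). -/
theorem norm_ofReal_add_mul_triZeta_le (a c : ℝ) :
    ‖(a : ℂ) + (c : ℂ) * triZeta‖ ≤ |a| + |c| := by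
  have hn : ‖triZeta‖ = 1 := by
    have h := normSq_triZeta
    rw [normSq_eq_norm_sq] at h
    nlinarith [norm_nonneg triZeta]
  calc ‖(a : ℂ) + (c : ℂ) * triZeta‖ ≤ ‖(a : ℂ)‖ + ‖(c : ℂ) * triZeta‖ := norm_add_le _ _
    _ = |a| + |c| := by rw [norm_mul, hn, mul_one, norm_real, norm_real,
        Real.norm_eq_abs, Real.norm_eq_abs]

/-- **Rounding to the lattice.** Every `w` is within distance `2` of the lattice point whose
coordinates are the integer parts of the coordinates of `w`. -/
theorem norm_sub_triEmbed_floor_le (w : ℂ) :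
    ‖w - triEmbed ![⌊w.re - w.im / triZeta.im * triZeta.re⌋, ⌊w.im / triZeta.im⌋]‖ ≤ 2 := by
  set a : ℝ := w.re - w.im / triZeta.im * triZeta.re with ha
  set c : ℝ := w.im / triZeta.im with hc
  have hrepr : w - triEmbed ![⌊a⌋, ⌊c⌋] =
      ((Int.fract a : ℝ) : ℂ) + ((Int.fract c : ℝ) : ℂ) * triZeta := by
    conv_lhs => rw [← latA_add_latC w]
    rw [triEmbed_eq_ofReal]
    simp only [Matrix.cons_val_zero, Matrix.cons_val_one, Int.fract, ← ha, ← hc]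
    push_cast
    ring
  rw [hrepr]
  have h1 : |Int.fract a| ≤ 1 :=
    abs_le.2 ⟨by linarith [Int.fract_nonneg a], (Int.fract_lt_one _).le⟩
  have h2 : |Int.fract c| ≤ 1 :=
    abs_le.2 ⟨by linarith [Int.fract_nonneg c], (Int.fract_lt_one _).le⟩
  linarith [norm_ofReal_add_mul_triZeta_le (Int.fract a) (Int.fract c)]

/-! ### The unit cells -/

/-- The coordinate map `w ↦ (coordinates of w)` is the linear map of the matrix
`[[1, -Re ζ / Im ζ], [0, 1 / Im ζ]]` in the basis `(1, i)`. -/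
theorem coordMap_apply (w : ℂ) :
    Matrix.toLin Complex.basisOneI Complex.basisOneI
        !![(1 : ℝ), -(triZeta.re / triZeta.im); 0, (triZeta.im)⁻¹] w =
      ⟨w.re - w.im / triZeta.im * triZeta.re, w.im / triZeta.im⟩ := by
  rw [Matrix.toLin_apply, Fin.sum_univ_two]
  simp only [Complex.coe_basisOneI_repr, Complex.coe_basisOneI, Fin.sum_univ_two,
    Matrix.mulVec, dotProduct, Matrix.cons_val_zero, Matrix.cons_val_one,
    Matrix.of_apply, Matrix.cons_val', Matrix.empty_val', Matrix.cons_val_fin_one]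
  apply Complex.ext
  · simp only [add_re, smul_re, one_re, I_re, smul_eq_mul, mul_one, mul_zero, add_zero]
    ring
  · simp only [add_im, smul_im, one_im, I_im, smul_eq_mul, mul_one, mul_zero, zero_add]
    ring

/-- Its determinant is `(Im ζ)⁻¹`. -/
theorem det_coordMap :
    LinearMap.det (Matrix.toLin Complex.basisOneI Complex.basisOneI
      !![(1 : ℝ), -(triZeta.re / triZeta.im); 0, (triZeta.im)⁻¹]) = (triZeta.im)⁻¹ := by
  rw [LinearMap.det_toLin, Matrix.det_fin_two_of]
  ring

/-- The unit square of index `k` as a preimage of a product of intervals. -/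
theorem sq_eq_preimage (k : Site 2) :
    {q : ℂ | ⌊q.re⌋ = k 0 ∧ ⌊q.im⌋ = k 1} = Complex.measurableEquivRealProd ⁻¹'
      (Ico (k 0 : ℝ) (k 0 + 1) ×ˢ Ico (k 1 : ℝ) (k 1 + 1)) := by
  ext q
  simp only [mem_setOf_eq, mem_preimage, mem_prod, mem_Ico, Int.floor_eq_iff]
  rfl

/-- The unit square has volume `1`. -/
theorem volume_sq (k : Site 2) : volume {q : ℂ | ⌊q.re⌋ = k 0 ∧ ⌊q.im⌋ = k 1} = 1 := by
  rw [sq_eq_preimage, Complex.volume_preserving_equiv_real_prod.measure_preimage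
    ((measurableSet_Ico.prod measurableSet_Ico).nullMeasurableSet)]
  rw [Measure.volume_eq_prod, Measure.prod_prod, Real.volume_Ico, Real.volume_Ico]
  simp

/-- The unit square is measurable. -/
theorem measurableSet_sq (k : Site 2) : MeasurableSet {q : ℂ | ⌊q.re⌋ = k 0 ∧ ⌊q.im⌋ = k 1} := by
  rw [sq_eq_preimage]
  exact Complex.measurableEquivRealProd.measurable (measurableSet_Ico.prod measurableSet_Ico)

/-- The unit lattice cell of index `k` as the preimage of the unit square under the coordinate
map. -/
theorem cell₁_eq_preimage (k : Site 2) :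
    {w : ℂ | ⌊w.re - w.im / triZeta.im * triZeta.re⌋ = k 0 ∧ ⌊w.im / triZeta.im⌋ = k 1} =
      Matrix.toLin Complex.basisOneI Complex.basisOneI
        !![(1 : ℝ), -(triZeta.re / triZeta.im); 0, (triZeta.im)⁻¹] ⁻¹'
        {q : ℂ | ⌊q.re⌋ = k 0 ∧ ⌊q.im⌋ = k 1} := by
  ext w
  simp only [mem_setOf_eq, mem_preimage, coordMap_apply]

/-- Unit lattice cells are measurable. -/
theorem measurableSet_cell₁ (k : Site 2) :
    MeasurableSet {w : ℂ | ⌊w.re - w.im / triZeta.im * triZeta.re⌋ = k 0 ∧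
      ⌊w.im / triZeta.im⌋ = k 1} := by
  rw [cell₁_eq_preimage]
  exact (LinearMap.continuous_of_finiteDimensional _).measurable (measurableSet_sq k)

/-- The volume of a unit lattice cell is `Im ζ`. -/
theorem volume_cell₁ (k : Site 2) :
    volume {w : ℂ | ⌊w.re - w.im / triZeta.im * triZeta.re⌋ = k 0 ∧ ⌊w.im / triZeta.im⌋ = k 1} =
      ENNReal.ofReal triZeta.im := by
  have him : 0 < triZeta.im := by rw [triZeta_im]; positivity
  rw [cell₁_eq_preimage, Measure.addHaar_preimage_linearMap _ (by rw [det_coordMap]; positivity),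
    det_coordMap, volume_sq, inv_inv, mul_one, abs_of_pos him]

/-! ### Scaled and shifted cells -/

/-- The cell of index `k` at mesh `δ` and offset `t`, as an affine preimage of the unit cell. -/
theorem cell_eq_preimage (δ : ℝ) (t : ℂ) (k : Site 2) :
    {z : ℂ | ⌊(z / δ - t).re - (z / δ - t).im / triZeta.im * triZeta.re⌋ = k 0 ∧
        ⌊(z / δ - t).im / triZeta.im⌋ = k 1} =
      (fun z : ℂ => (δ⁻¹ : ℝ) • z) ⁻¹' ((fun w : ℂ => -t + w) ⁻¹'
        {w : ℂ | ⌊w.re - w.im / triZeta.im * triZeta.re⌋ = k 0 ∧ ⌊w.im / triZeta.im⌋ = k 1}) := by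
  ext z
  simp only [mem_setOf_eq, mem_preimage]
  have : z / δ - t = -t + (δ⁻¹ : ℝ) • z := by
    rw [Complex.real_smul]; push_cast; ring
  rw [this]

/-- Cells are measurable. -/
theorem measurableSet_cell (δ : ℝ) (t : ℂ) (k : Site 2) :
    MeasurableSet {z : ℂ | ⌊(z / δ - t).re - (z / δ - t).im / triZeta.im * triZeta.re⌋ = k 0 ∧
      ⌊(z / δ - t).im / triZeta.im⌋ = k 1} := by
  rw [cell_eq_preimage]
  exact (measurable_const_smul _) ((measurable_const_add _) (measurableSet_cell₁ k))

/-- The volume of a cell is `δ² · Im ζ`. -/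
theorem volume_cell {δ : ℝ} (hδ : 0 < δ) (t : ℂ) (k : Site 2) :
    volume {z : ℂ | ⌊(z / δ - t).re - (z / δ - t).im / triZeta.im * triZeta.re⌋ = k 0 ∧
        ⌊(z / δ - t).im / triZeta.im⌋ = k 1} = ENNReal.ofReal (δ ^ 2 * triZeta.im) := by
  have him : 0 < triZeta.im := by rw [triZeta_im]; positivity
  rw [cell_eq_preimage, Measure.addHaar_preimage_smul _ (inv_ne_zero hδ.ne'), measure_preimage_add,
    volume_cell₁, Complex.finrank_real_complex]
  rw [inv_pow, inv_inv, ← ENNReal.ofReal_mul (by positivity)]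
  congr 1
  rw [abs_of_pos (by positivity)]

/-- The real volume of a cell. -/
theorem volume_real_cell {δ : ℝ} (hδ : 0 < δ) (t : ℂ) (k : Site 2) :
    volume.real {z : ℂ | ⌊(z / δ - t).re - (z / δ - t).im / triZeta.im * triZeta.re⌋ = k 0 ∧
        ⌊(z / δ - t).im / triZeta.im⌋ = k 1} = δ ^ 2 * triZeta.im := by
  rw [measureReal_def, volume_cell hδ, ENNReal.toReal_ofReal]
  have him : 0 < triZeta.im := by rw [triZeta_im]; positivity
  positivity

/-- Only finitely many sample points `δ (triEmbed k + t)` fall in a bounded set. -/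
theorem finite_pt_mem {δ : ℝ} (hδ : 0 < δ) (t : ℂ) {S : Set ℂ} (hS : Bornology.IsBounded S) :
    {k : Site 2 | (δ : ℂ) * (triEmbed k + t) ∈ S}.Finite := by
  obtain ⟨R, hR⟩ := hS.subset_closedBall 0
  set N : ℤ := ⌈2 * (R / δ + ‖t‖)⌉
  refine Set.Finite.subset (Set.Finite.pi (t := fun _ : Fin 2 => Set.Icc (-N) N)
    fun _ => Set.finite_Icc _ _) ?_
  intro k hk
  simp only [mem_setOf_eq] at hk
  have hk' : ‖(δ : ℂ) * (triEmbed k + t)‖ ≤ R := mem_closedBall_zero_iff.1 (hR hk)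
  rw [norm_mul, norm_real, Real.norm_eq_abs, abs_of_pos hδ] at hk'
  have h1 : ‖triEmbed k + t‖ ≤ R / δ := by
    rw [le_div_iff₀ hδ]; linarith
  have h2 : ‖triEmbed k‖ ≤ R / δ + ‖t‖ := by
    have := norm_add_le (triEmbed k + t) (-t)
    rw [add_neg_cancel_right, norm_neg] at this
    linarith
  simp only [Set.mem_pi, mem_univ, mem_Icc, forall_true_left]
  intro i
  have h3 := abs_le_two_mul_norm_triEmbed k i
  have h4 : |(k i : ℝ)| ≤ N := by
    calc |(k i : ℝ)| ≤ 2 * (R / δ + ‖t‖) := by linarith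
      _ ≤ N := Int.le_ceil _
  have h5 : ((|k i| : ℤ) : ℝ) ≤ N := by push_cast; exact h4
  have h6 : |k i| ≤ N := by exact_mod_cast h5
  exact abs_le.1 h6

/-! ### Riemann sums over one coset -/

/-- **Riemann sums over one coset of the triangular lattice.** For `g` continuous with compact
support, `δ² Σ_k g(δ(triEmbed k + t)) → (Im ζ)⁻¹ ∫ g` as `δ → 0⁺`. -/
theorem tendsto_coset_sum {g : ℂ → ℂ} (hg : Continuous g) (hgs : HasCompactSupport g) (t : ℂ) :
    Tendsto (fun δ : ℝ => (δ : ℂ) ^ 2 * ∑ᶠ k : Site 2, g ((δ : ℂ) * (triEmbed k + t))) (𝓝[>] 0)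
      (𝓝 (((triZeta.im)⁻¹ : ℝ) * ∫ z, g z)) := by
  have him : 0 < triZeta.im := by rw [triZeta_im]; positivity
  set S := tsupport g with hS_def
  have hS : IsCompact S := hgs
  set S₁ := cthickening 1 S with hS₁_def
  have hS₁ : IsCompact S₁ := hS.cthickening
  have hS₁top : volume S₁ < ⊤ := hS₁.measure_lt_top
  set V : ℝ := volume.real S₁ with hV
  have hV0 : 0 ≤ V := measureReal_nonneg
  have hguc : UniformContinuous g := hgs.uniformContinuous_of_continuous hg
  have hgint : Integrable g := hg.integrable_of_hasCompactSupport hgs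
  rw [Metric.tendsto_nhdsWithin_nhds]
  intro ε hε
  set ε' : ℝ := ε * triZeta.im / (2 * (V + 1)) with hε'
  have hε'0 : 0 < ε' := by positivity
  obtain ⟨θ, hθ, hθuc⟩ := Metric.uniformContinuous_iff.1 hguc ε' hε'0
  refine ⟨min (1 / 2) (θ / 4), by positivity, fun δ hδ0 hδd => ?_⟩
  have hδ : 0 < δ := hδ0
  have hδ' : (δ : ℂ) ≠ 0 := ofReal_ne_zero.2 hδ.ne'
  rw [Real.dist_eq, sub_zero, abs_of_pos hδ, lt_min_iff] at hδd
  have hδ1 : 2 * δ ≤ 1 := by linarith [hδd.1]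
  have hδθ : 2 * δ < θ := by linarith [hδd.2]
  -- sample points, cell index, cells
  set pt : Site 2 → ℂ := fun k => (δ : ℂ) * (triEmbed k + t) with hpt
  set idx : ℂ → Site 2 := fun z =>
    ![⌊(z / δ - t).re - (z / δ - t).im / triZeta.im * triZeta.re⌋, ⌊(z / δ - t).im / triZeta.im⌋]
    with hidx
  set cell : Site 2 → Set ℂ := fun k => {z | idx z = k} with hcell
  have hcell_eq : ∀ k, cell k =
      {z : ℂ | ⌊(z / δ - t).re - (z / δ - t).im / triZeta.im * triZeta.re⌋ = k 0 ∧
        ⌊(z / δ - t).im / triZeta.im⌋ = k 1} := by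
    intro k
    ext z
    simp only [hcell, hidx, mem_setOf_eq]
    constructor
    · rintro rfl; simp
    · rintro ⟨h0, h1⟩
      ext i; fin_cases i
      · simpa using h0
      · simpa using h1
  have hidx_pt : ∀ k, idx (pt k) = k := by
    intro k
    have h : pt k / δ - t = triEmbed k := by
      rw [hpt]; simp only; rw [mul_div_cancel_left₀ _ hδ', add_sub_cancel_right]
    simp only [hidx, h]
    rw [triEmbed_eq_ofReal, latA_of, latC_of, Int.floor_intCast, Int.floor_intCast]
    ext i; fin_cases i <;> simp
  have hdist : ∀ z, dist z (pt (idx z)) ≤ 2 * δ := by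
    intro z
    have hz : z - pt (idx z) = (δ : ℂ) * ((z / δ - t) - triEmbed (idx z)) := by
      rw [hpt]; simp only; field_simp; ring
    rw [dist_eq_norm, hz, norm_mul, norm_real, Real.norm_eq_abs, abs_of_pos hδ]
    have := norm_sub_triEmbed_floor_le (z / δ - t)
    simp only [hidx]
    nlinarith
  -- the finite set of relevant indices
  have hfin : {k : Site 2 | pt k ∈ S}.Finite := finite_pt_mem hδ t hS.isBounded
  set Kf := hfin.toFinset with hKf
  have hKf : ∀ k, k ∉ Kf → g (pt k) = 0 := by
    intro k hk
    rw [Set.Finite.mem_toFinset, mem_setOf_eq] at hk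
    exact image_eq_zero_of_notMem_tsupport hk
  have hsupp : Function.support (fun k => g (pt k)) ⊆ Kf := by
    intro k hk
    by_contra h
    exact hk (hKf k (by simpa using h))
  have hsum : ∑ᶠ k : Site 2, g (pt k) = ∑ k ∈ Kf, g (pt k) :=
    finsum_eq_sum_of_support_subset _ hsupp
  -- the step function
  set gδ : ℂ → ℂ := fun z => g (pt (idx z)) with hgδ
  have hgδ_eq : gδ = fun z => ∑ k ∈ Kf, (cell k).indicator (fun _ => g (pt k)) z := by
    funext z
    simp only [hgδ, Set.indicator_apply, hcell, mem_setOf_eq]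
    rw [Finset.sum_ite_eq Kf (idx z) (fun k => g (pt k))]
    split_ifs with h
    · rfl
    · exact hKf _ h
  have hmeas : ∀ k, MeasurableSet (cell k) := fun k => by
    rw [hcell_eq]; exact measurableSet_cell δ t k
  have hvol : ∀ k, volume.real (cell k) = δ ^ 2 * triZeta.im := fun k => by
    rw [hcell_eq]; exact volume_real_cell hδ t k
  have hint_ind : ∀ k ∈ Kf, Integrable ((cell k).indicator (fun _ : ℂ => g (pt k))) := by
    intro k _
    refine (integrable_indicator_iff (hmeas k)).2 (integrableOn_const ?_)
    rw [hcell_eq, volume_cell hδ]; exact ENNReal.ofReal_ne_top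
  have hgδint : Integrable gδ := by
    rw [hgδ_eq]; exact integrable_finsetSum _ hint_ind
  have hgδ_integral : ∫ z, gδ z = ((δ ^ 2 * triZeta.im : ℝ) : ℂ) * ∑ k ∈ Kf, g (pt k) := by
    rw [hgδ_eq, integral_finsetSum _ hint_ind, Finset.mul_sum]
    refine Finset.sum_congr rfl fun k _ => ?_
    rw [integral_indicator_const _ (hmeas k), hvol k, Complex.real_smul]
  -- pointwise comparison
  have hptw : ∀ z, ‖g z - gδ z‖ ≤ ε' := by
    intro z
    have hd : dist z (pt (idx z)) < θ := (hdist z).trans_lt hδθ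
    have := hθuc hd
    rw [dist_eq_norm] at this
    exact this.le
  have hzero : ∀ z, z ∉ S₁ → g z - gδ z = 0 := by
    intro z hz
    have hz' : z ∉ S := fun h => hz (self_subset_cthickening _ h)
    have hp : pt (idx z) ∉ S := by
      intro h
      exact hz (mem_cthickening_of_dist_le z (pt (idx z)) 1 S h ((hdist z).trans hδ1))
    simp only [hgδ, image_eq_zero_of_notMem_tsupport hz', image_eq_zero_of_notMem_tsupport hp,
      sub_zero]
  have hdiff : ‖(∫ z, g z) - ∫ z, gδ z‖ ≤ ε' * V := by
    rw [← integral_sub hgint hgδint, ← setIntegral_eq_integral_of_forall_compl_eq_zero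
      (fun z hz => hzero z hz)]
    exact norm_setIntegral_le_of_norm_le_const hS₁top fun z _ => hptw z
  -- assemble
  show dist ((δ : ℂ) ^ 2 * ∑ᶠ k : Site 2, g (pt k)) _ < ε
  rw [hsum, dist_eq_norm]
  have him' : (triZeta.im : ℂ) ≠ 0 := ofReal_ne_zero.2 him.ne'
  have key : (δ : ℂ) ^ 2 * ∑ k ∈ Kf, g (pt k) = ((triZeta.im)⁻¹ : ℝ) * ∫ z, gδ z := by
    rw [hgδ_integral, ← mul_assoc]
    congr 1
    push_cast
    field_simp
  rw [key, ← mul_sub, norm_mul, norm_real, Real.norm_eq_abs, abs_of_pos (inv_pos.2 him),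
    ← neg_sub, norm_neg]
  calc (triZeta.im)⁻¹ * ‖(∫ z, g z) - ∫ z, gδ z‖ ≤ (triZeta.im)⁻¹ * (ε' * V) := by gcongr
    _ = ε * (V / (2 * (V + 1))) := by rw [hε']; field_simp
    _ < ε := by
        have : V / (2 * (V + 1)) < 1 := by
          rw [div_lt_one (by positivity)]; linarith
        nlinarith

end Summit.CriticalPhenomena.SAWScalingLimit.Theorems.RetrievalSynthesisR
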